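import Summits.BirchSwinnertonDyer.BirchSwinnertonDyer.Theorems.ThetaPartnerAtTwoMazurTateCongruenceAtTwoRPlusLineOfManinConstant
import Summits.BirchSwinnertonDyer.BirchSwinnertonDyer.Theorems.ThetaPartnerAtTwoMazurTateCongruenceAtTwoTopOfThreeFacts
import Summits.BirchSwinnertonDyer.BirchSwinnertonDyer.Theorems.ThetaPartnerAtTwoSignedTransportAtTwoRankZeroOfGZK
import Literature.NumberTheory.EllipticCurves.ModularParametrizationDegreeHoldsProofs
import HarnessLib

/-!
# Crux `MazurTateCongruenceAtTwoTop` (stmt-BirchSwinnertonDyer-25797 = `MazurTateCongruenceAtTwoR` 21416 BY NAME), line `symbol`: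
# THE K1 FLOOR WITHOUT THE ASSEMBLED EICHLER–SHIMURA FACT — `mazurTateCongruenceAtTwoTop_of_sdBzAu (hSD) (hBz) (hAU)` (PUB³),
# `…_of_sdBz_periodTwo (hSD) (hBz) (h2)` (PUB² + the period fact), and the μ-INV₂ / K1Ar / Kan⁺ twins
# (width seat bsd-wall-tp2-p1-w2 g5; `--supports stmt-BirchSwinnertonDyer-25797`; THEOREMS ONLY — no `def`, no `sorry`; BSD is not proved)

STATE OF RECORD BEFORE THIS FILE. K1 ⟸ PUB⁴ {ES, SD, Bz, AU} (`mazurTateCongruenceAtTwoTop_of_esSdBzAu`, tp2-p1-w4 g0, p635144), where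
ES = `eichlerShimura_depletedOptimalQuotient_periodLattice_of_dvd` is an ASSEMBLED named fact (optimal quotient of `J₀(L)` attached to the
`S`-depleted oldform; no single printed statement). THIS FILE removes ES from every K1 / Kan⁺ closer of `…TopOfThreeFacts` — statements otherwise
VERBATIM, proofs copied with the plus line `plusLineCharTwo_of_threeFacts hES hSD hBz` replaced by `plusLineCharTwo_of_sdBz hSD hBz`:
* §0 `plusLineCharTwo_of_sdBz` = `plusLineCharTwo_of_mcSdBz` (`…RPlusLineOfManinConstant`, this seat) with its binder
  `IsNewformOf.exists_maninConstant_ne_zero` DISCHARGED by the tree theorem `IsNewformOf.exists_maninConstant_ne_zero_holds`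
  (`ModularParametrizationDegreeHoldsProofs`: Shimura's construction + Eichler–Shimura congruence for `ℂ/Λ_f` by Honda's method + Faltings);
  underneath, the depleted-lattice input is `DepletedLattice.exists_depletedLatticeCurve_isIsogenous` (`…RDepletedPeriodLattice`, p636031).
* §1 K1: `mazurTateCongruenceAtTwoTop_of_sdBz_periodTwo_depletedUnitNegDisc / _depletionPrimitiveNegDisc / _ihara`,
  **`mazurTateCongruenceAtTwoTop_of_sdBz_periodTwo`** (PUB² {SD, Bz} + `realPeriodRat_eq_unit_mul_plusPeriod_two`),
  **`mazurTateCongruenceAtTwoTop_of_sdBzAu`** (PUB³ {SD, Bz, AU}: from `h : PublishedInputsHeckeAtTwo` use `… h.2.1 h.2.2.1 h.2.2.2.2` — the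
  conjuncts ES (`h.1`) and Se (`h.2.2.2.1`) of item 27435 are now BOTH idle for K1), the `MazurTateCongruenceAtTwoR` twins, and
  `muInvarianceAtTwo_of_sdBz_periodTwo` (Greenberg–Vatsal `μ`-invariance at `2` on the theta habitat from PUB² + the period fact).
* §2 K1Ar: `SignedTransportAtTwo.signedTransportAtTwo_rankZero_of_gzk_of_sdBzAu` (GZK + PUB³).
* §3 Kan⁺ (RTT 20688): `thetaLayerLambdaCongruenceAtTwo_of_sdBz_flatMuZeroAtTwo`, `…_of_sdBzAu_signedMuAnalytic`,
  `…_of_sdBz_periodUnit_signedMuAnalytic`, `kanP3_of_pub_of_signedMuAnalyticAtTwoPlus : SD → Bz → AU → SignedMuAnalyticAtTwoPlus → Kan⁺`.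

HONEST FRAMING: every theorem is CONDITIONAL on its displayed named facts (Hecke self-duality of `J₀(N)[ℓ]`, Buzzard 2000 Prop. 2.4,
Abbes–Ullmo Thm. A or the period fact at `2`; for Kan⁺ also the open item 21437 or FLAT); nothing closes an item; BSD is not proved by any of this.

References: Greenberg–Vatsal, Invent. Math. 142 (2000) Thm. (1.4), §3 (13) [GreenbergVatsal2000]; Vatsal, Duke 98 (1999) Thm. (1.10) [Vatsal1999];
Buzzard, MRL 7 (2000) Prop. 2.4 [Buzzard2000LevelLoweringModTwo]; Darmon–Diamond–Taylor (1995) §1.6, §4.5 [DarmonDiamondTaylor1995];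
Abbes–Ullmo, Compositio 103 (1996) Thm. A [AbbesUllmo1996]; BCDT, JAMS 14 (2001) p. 845 [BCDTJAMS2001]; Knapp (1993) Thm. 11.74 [Knapp1993];
Pollack, Duke 118 (2003) [Pollack2003]; B. D. Kim, Compos. Math. 145 (2009) [BDKim2009].
-/

-- justification: the `Summit.BirchSwinnertonDyer.BirchSwinnertonDyer.…` path repeats a component (route-file convention)
set_option linter.dupNamespace false
set_option autoImplicit false

noncomputable section

open scoped Classical MatrixGroups ModularForm

open CongruenceSubgroup Polynomial WeierstrassCurve NumberField IsDedekindDomain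
  Literature.NumberTheory.IwasawaTheory Literature.NumberTheory.EllipticCurves Literature.NumberTheory.EllipticCurves.ModularForms
  Literature.NumberTheory.EllipticCurves.Rank1Residual Literature.NumberTheory.EllipticCurves.GreenbergVatsal2000
  Literature.NumberTheory.EllipticCurves.Sprung2017
  Summit.BirchSwinnertonDyer.Rank1Residual.Supersingular
  Summit.BirchSwinnertonDyer.BirchSwinnertonDyer.Theorems.ThetaLayerLambdaCongruenceAtTwo

/-! ## §0 The plus line (C3k) from TWO print facts {SD, Bz} — `hMC` discharged -/

namespace Summit.BirchSwinnertonDyer.BirchSwinnertonDyer.Theorems.ThetaLayerLambdaCongruenceAtTwo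

/-- **(C3k) «plus multiplicity one over fields of characteristic `2`» from the TWO named facts {SD, Bz}** — `plusLineCharTwo_of_mcSdBz`
(`…RPlusLineOfManinConstant`) with its first binder DISCHARGED by the tree theorem `IsNewformOf.exists_maninConstant_ne_zero_holds`
(`ModularParametrizationDegreeHoldsProofs`: Shimura's construction with the Eichler–Shimura congruence for `ℂ/Λ_f` by Honda's formal-group
method, and Faltings' isogeny theorem along Bost–André); CONCLUSION VERBATIM that of `plusLineCharTwo_of_fourFacts` / `_of_threeFacts`.
USE: every `plusLineCharTwo_of_threeFacts hES hSD hBz` ↦ `plusLineCharTwo_of_sdBz hSD hBz` (same type). BSD is not proved by this.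
[cite: Buzzard2000LevelLoweringModTwo, Prop. 2.4 and Def. 2.1–2.2 (p. 100–101)] [cite: BCDTJAMS2001, p. 845, "(2) ⇒ (6)"]
[cite: DarmonDiamondTaylor1995, §1.6 Lemma 1.38 and §4.5 Thm. 4.26] -/
theorem plusLineCharTwo_of_sdBz (hSD : heckeSelfDual_torsionBy_J0) (hBz : buzzard2000_multiplicityOne_gamma0) :
    ∀ (W : WeierstrassCurve ℚ) [W.IsElliptic] [W.IsGloballyMinimal], GoodSS W 2 → W.Δ < 0 → ∀ (N' : ℕ), Odd N' →
    ∀ {N : ℕ} [NeZero N] (f : CuspForm (Gamma0 N) 2), IsNewformOf W f →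
    ∀ (S : Finset ℕ), (∀ ℓ ∈ S, ℓ.Prime) → S.Nonempty → N * ∏ ℓ ∈ S, ℓ ^ 2 ∣ N' → (∀ p : ℕ, p.Prime → p ∣ N' → p ∈ S) →
    (∀ v : HeightOneSpectrum (𝓞 ℚ), ¬ ((Rat.HeightOneSpectrum.primesEquiv v : ℕ) ∣ 2 * N') → W.HasGoodReductionAt v) →
    ∀ (k : Type) [Field k] [CharP k 2] (Ψ₁ Ψ₂ : ℚ → k), (∀ (r : ℚ) (z : ℤ), Ψ₁ (r + z) = Ψ₁ r) → (∀ r : ℚ, Ψ₁ (-r) = Ψ₁ r) → (∀ (γ : CongruenceSubgroup.Gamma0 (N')) (r : ℚ), ((γ : SL(2, ℤ)) 1 0 : ℚ) * r + ((γ : SL(2, ℤ)) 1 1 : ℚ) ≠ 0 → Ψ₁ ((((γ : SL(2, ℤ)) 0 0 : ℚ) * r + ((γ : SL(2, ℤ)) 0 1 : ℚ)) / (((γ : SL(2, ℤ)) 1 0 : ℚ) * r + ((γ : SL(2, ℤ)) 1 1 : ℚ))) = (if ((γ : SL(2, ℤ)) 1 0) = 0 then 0 else Ψ₁ ((((γ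 : SL(2, ℤ)) 0 0 : ℚ)) / (((γ : SL(2, ℤ)) 1 0 : ℚ)))) + Ψ₁ r) → (∀ (r : ℚ) (z : ℤ), Ψ₂ (r + z) = Ψ₂ r) → (∀ r : ℚ, Ψ₂ (-r) = Ψ₂ r) → (∀ (γ : CongruenceSubgroup.Gamma0 (N')) (r : ℚ), ((γ : SL(2, ℤ)) 1 0 : ℚ) * r + ((γ : SL(2, ℤ)) 1 1 : ℚ) ≠ 0 → Ψ₂ ((((γ : SL(2, ℤ)) 0 0 : ℚ) * r + ((γ : SL(2, ℤ)) 0 1 : ℚ)) / (((γ : SL(2, ℤ)) 1 0 : ℚ) * r + ((γ : SL(2, ℤ)) 1 1 : ℚ))) = (if ((γ : SL(2, ℤ)) 1 0) = 0 then 0 else Ψ₂ ((((γ : SL(2, ℤ)) 0 0 : ℚ)) / (((γ : SL(2, ℤ)) 1 0 : ℚ)))) + Ψ₂ r) → (∃ r : ℚ, Ψ₁ r ≠ 0) → (∃ r : ℚ, Ψ₂ r ≠ 0) → (∀ q : ℕ, q.Prime → ¬ q ∣ N' → ∀ r : ℚ, (∑ j : Fin q, Ψ₁ ((r + j) / q))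 + Ψ₁ (q * r) = (W.LFunction q : k) * Ψ₁ r) → (∀ q : ℕ, q.Prime → ¬ q ∣ N' → ∀ r : ℚ, (∑ j : Fin q, Ψ₂ ((r + j) / q)) + Ψ₂ (q * r) = (W.LFunction q : k) * Ψ₂ r) → (∀ ℓ : ℕ, ℓ.Prime → ℓ ∣ N' → ∀ r : ℚ, ∑ j : Fin ℓ, Ψ₁ ((r + j) / ℓ) = 0) → (∀ ℓ : ℕ, ℓ.Prime → ℓ ∣ N' → ∀ r : ℚ, ∑ j : Fin ℓ, Ψ₂ ((r + j) / ℓ) = 0) → ∃ c : k, ∀ r : ℚ, Ψ₂ r = c * Ψ₁ r :=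
  plusLineCharTwo_of_mcSdBz IsNewformOf.exists_maninConstant_ne_zero_holds hSD hBz

end Summit.BirchSwinnertonDyer.BirchSwinnertonDyer.Theorems.ThetaLayerLambdaCongruenceAtTwo

/-! ## §1 K1 `MazurTateCongruenceAtTwoTop` BY NAME without the assembled Eichler–Shimura fact (and without Serre 1972) -/

namespace Summit.BirchSwinnertonDyer.BirchSwinnertonDyer.Theorems.MazurTateCongruenceAtTwoR

/-- **`MazurTateCongruenceAtTwoTop` BY NAME from PUB² {SD, Bz} + the period fact + (DU₂⁻)** — tp2-p1-w4 g0's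
`mazurTateCongruenceAtTwoTop_of_threeFacts_periodTwo_depletedUnitNegDisc` (the lead's `…_of_fourFacts_depletedUnitNegDisc`) with the plus line
`plusLineCharTwo_of_threeFacts hES hSD hBz` replaced by the ES-FREE `plusLineCharTwo_of_sdBz hSD hBz` (pointwise through
`mazurTateCongruence_of_plusLine`; both curves of a theta pair have `Δ < 0`). BSD is not proved by this.
[cite: GreenbergVatsal2000, Thm. (1.4), §3 (13)] [cite: Buzzard2000LevelLoweringModTwo, Prop. 2.4] -/
theorem mazurTateCongruenceAtTwoTop_of_sdBz_periodTwo_depletedUnitNegDisc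
    (hSD : heckeSelfDual_torsionBy_J0)
    (hBz : buzzard2000_multiplicityOne_gamma0) (h2 : realPeriodRat_eq_unit_mul_plusPeriod_two)
    (hDU : ∀ (E : WeierstrassCurve ℚ) [E.IsElliptic] [E.IsGloballyMinimal], GoodSS E 2 → E.frobeniusTrace 2 = 0 → E.Δ < 0 →
      ∀ [NeZero (E.conductorNorm ℤ)] (f : CuspForm (Gamma0 (E.conductorNorm ℤ)) 2), IsNewformOf E f →
      ∀ (ϖ : ℚ), (ϖ : ℝ) * E.realPeriodRat = plusPeriod f →
      ∀ (S₀ : Finset (HeightOneSpectrum (𝓞 ℚ))), (∀ v ∈ S₀, ((2 : ℕ) : 𝓞 ℚ) ∉ v.asIdeal) →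
        (∀ v : HeightOneSpectrum (𝓞 ℚ), ¬ E.HasGoodReductionAt v → v ∈ S₀) →
      ∃ x₀ : ℚ, ‖algebraMap ℚ (PadicAlgCl 2) (2 * ϖ) * (∑ k ∈ Fintype.piFinset (fun _ : S₀ ↦ Finset.range 3), (∏ v : S₀, ((E.localPolynomialAt (v : HeightOneSpectrum (𝓞 ℚ))).map (Int.castRingHom (PadicAlgCl 2))).coeff (k v) * ((Rat.HeightOneSpectrum.natGenerator (v : HeightOneSpectrum (𝓞 ℚ)) : PadicAlgCl 2)⁻¹) ^ (k v)) * algebraMap ℚ (PadicAlgCl 2) (ratPlusSymbol f (x₀ * ((∏ v : S₀, Rat.HeightOneSpectrum.natGenerator (v : HeightOneSpectrum (𝓞 ℚ)) ^ (k v) : ℕ) : ℚ))))‖ = 1) :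
    Summit.BirchSwinnertonDyer.BirchSwinnertonDyer.Theses.ThetaPartnerAtTwo.MazurTateCongruenceAtTwoTop := by
  intro W _ _ A _ _ _ _ hss ha hAcm hAss hAa he γ _ _ f hf ϖ hϖ Lplus Lminus hPP _ fA hfA ϖA hϖA LplusA LminusA hPPA
    S₀ hS2 hSW hSA G m hG GA m' hGA
  have hΔ : W.Δ < 0 := by
    obtain ⟨e, he'⟩ := he
    exact ThetaPartnerXRoute.Δ_neg_of_cmPartner_two W A hAcm hAss e he'
  have hΔA : A.Δ < 0 := ThetaPartnerXRoute.Δ_neg_of_hasCM_of_goodSS_two A hAcm hAss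
  exact mazurTateCongruence_of_plusLine W A (plusLineAtTwoLevel_of_charTwoLevel (plusLineCharTwo_of_sdBz hSD hBz))
    hss hΔ hAss he f hf ϖ hPP fA hfA ϖA hPPA S₀ hS2 hSW hSA
    (symbolMu_of_exists_depletedUnit W h2 hss ha hf hϖ S₀ hS2 (hDU W hss ha hΔ f hf ϖ hϖ S₀ hS2 hSW))
    (symbolMu_of_exists_depletedUnit A h2 hAss hAa hfA hϖA S₀ hS2 (hDU A hAss hAa hΔA fA hfA ϖA hϖA S₀ hS2 hSA)) hG hGA

/-- **`MazurTateCongruenceAtTwoTop` BY NAME from PUB² {SD, Bz} + the period fact + (DP₂⁻) «depletion preserves primitivity, for `Δ < 0`»**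
(`…_of_threeFacts_periodTwo_depletionPrimitiveNegDisc` minus `ES`). BSD is not proved by this. [cite: Ribet1984ICM, Thm. 4.3]
[cite: GreenbergVatsal2000, §3 (13) and Remark 3.4] -/
theorem mazurTateCongruenceAtTwoTop_of_sdBz_periodTwo_depletionPrimitiveNegDisc
    (hSD : heckeSelfDual_torsionBy_J0)
    (hBz : buzzard2000_multiplicityOne_gamma0) (h2 : realPeriodRat_eq_unit_mul_plusPeriod_two)
    (hDP : ∀ (E : WeierstrassCurve ℚ) [E.IsElliptic] [E.IsGloballyMinimal], GoodSS E 2 → E.frobeniusTrace 2 = 0 → E.Δ < 0 →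
      ∀ [NeZero (E.conductorNorm ℤ)] (f : CuspForm (Gamma0 (E.conductorNorm ℤ)) 2), IsNewformOf E f →
      ∀ (ϖ : ℚ), (ϖ : ℝ) * E.realPeriodRat = plusPeriod f →
      ∀ (S₀ : Finset (HeightOneSpectrum (𝓞 ℚ))), (∀ v ∈ S₀, ((2 : ℕ) : 𝓞 ℚ) ∉ v.asIdeal) →
        (∀ v : HeightOneSpectrum (𝓞 ℚ), ¬ E.HasGoodReductionAt v → v ∈ S₀) →
      (∃ r : ℚ, ‖algebraMap ℚ (PadicAlgCl 2) (2 * ϖ) * algebraMap ℚ (PadicAlgCl 2) (ratPlusSymbol f r)‖ = 1) →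
      ∃ x₀ : ℚ, ‖algebraMap ℚ (PadicAlgCl 2) (2 * ϖ) * (∑ k ∈ Fintype.piFinset (fun _ : S₀ ↦ Finset.range 3), (∏ v : S₀, ((E.localPolynomialAt (v : HeightOneSpectrum (𝓞 ℚ))).map (Int.castRingHom (PadicAlgCl 2))).coeff (k v) * ((Rat.HeightOneSpectrum.natGenerator (v : HeightOneSpectrum (𝓞 ℚ)) : PadicAlgCl 2)⁻¹) ^ (k v)) * algebraMap ℚ (PadicAlgCl 2) (ratPlusSymbol f (x₀ * ((∏ v : S₀, Rat.HeightOneSpectrum.natGenerator (v : HeightOneSpectrum (𝓞 ℚ)) ^ (k v) : ℕ) : ℚ))))‖ = 1) :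
    Summit.BirchSwinnertonDyer.BirchSwinnertonDyer.Theses.ThetaPartnerAtTwo.MazurTateCongruenceAtTwoTop := by
  refine mazurTateCongruenceAtTwoTop_of_sdBz_periodTwo_depletedUnitNegDisc hSD hBz h2 ?_
  intro E _ _ hss ha hΔ _ f hf ϖ hϖ S₀ hS2 hSE
  exact hDP E hss ha hΔ f hf ϖ hϖ S₀ hS2 hSE (exists_undepletedUnit E h2 hss hf hϖ)

/-- **`MazurTateCongruenceAtTwoTop` BY NAME from PUB² {SD, Bz} + the period fact + (IH₂⁻) «Ihara's lemma mod `2` in symbol form»**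
(`…_of_threeFacts_periodTwo_ihara` minus `ES`). BSD is not proved by this. [cite: Ribet1984ICM, Thm. 4.1 and Thm. 4.3]
[cite: GreenbergVatsal2000, §3 (13)] -/
theorem mazurTateCongruenceAtTwoTop_of_sdBz_periodTwo_ihara
    (hSD : heckeSelfDual_torsionBy_J0)
    (hBz : buzzard2000_multiplicityOne_gamma0) (h2 : realPeriodRat_eq_unit_mul_plusPeriod_two)
    (hIH : ∀ (W : WeierstrassCurve ℚ) [W.IsElliptic] [W.IsGloballyMinimal], GoodSS W 2 → W.Δ < 0 → ∀ (N' : ℕ), Odd N' →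
      (∀ v : IsDedekindDomain.HeightOneSpectrum (NumberField.RingOfIntegers ℚ), ¬ ((Rat.HeightOneSpectrum.primesEquiv v : ℕ) ∣ 2 * N') → W.HasGoodReductionAt v) →
      ∀ (ℓ : ℕ), ℓ.Prime → ℓ ≠ 2 → ∀ (Φ : ℚ → PadicAlgCl 2),
      (∀ (r : ℚ) (z : ℤ), Φ (r + z) = Φ r) → (∀ r : ℚ, Φ (-r) = Φ r) → (∀ (γ : CongruenceSubgroup.Gamma0 (N')) (r : ℚ), ((γ : SL(2, ℤ)) 1 0 : ℚ) * r + ((γ : SL(2, ℤ)) 1 1 : ℚ) ≠ 0 → Φ ((((γ : SL(2, ℤ)) 0 0 : ℚ) * r + ((γ : SL(2, ℤ)) 0 1 : ℚ)) / (((γ : SL(2, ℤ)) 1 0 : ℚ) * r + ((γ : SL(2, ℤ)) 1 1 : ℚ))) = (if ((γ : SL(2, ℤ)) 1 0) = 0 then 0 else Φ ((((γ : SL(2, ℤ)) 0 0 : ℚ)) / (((γ : SL(2, ℤ)) 1 0 : ℚ)))) + Φ r) →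
      (∀ r : ℚ, ‖Φ r‖ ≤ 1) →
      (∀ q : ℕ, q.Prime → ¬ q ∣ 2 * N' * ℓ → ∀ r : ℚ, ‖(∑ j : Fin q, Φ ((r + j) / q)) + Φ (q * r) - (W.LFunction q : PadicAlgCl 2) * Φ r‖ < 1) →
      (∀ (r : ℚ) (j : ℤ) (n : ℕ), ‖Φ (r + j / (ℓ : ℚ) ^ n) - Φ r‖ < 1) →
      ∀ r : ℚ, ‖Φ r‖ < 1) :
    Summit.BirchSwinnertonDyer.BirchSwinnertonDyer.Theses.ThetaPartnerAtTwo.MazurTateCongruenceAtTwoTop :=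
  mazurTateCongruenceAtTwoTop_of_sdBz_periodTwo_depletionPrimitiveNegDisc hSD hBz h2 (stub_depletionPrimitiveNegDisc_of_ihara h2 hIH)

/-- **THE CRUX BY NAME FROM PUB² {SD, Bz} + THE PERIOD FACT AT `2`, nothing else** — (IH₂⁻) is the landed theorem
`stub_iharaSymbolModTwoNegDisc`, (DP₂⁻) the landed `stub_depletionPrimitiveNegDisc_of_ihara`, the plus line is Serre-free (w4 g0) and ES-free
(`plusLineCharTwo_of_sdBz`: the Eichler–Shimura depleted-lattice input is the tree theorem `DepletedLattice.exists_depletedLatticeCurve_isIsogenous`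
fed with `IsNewformOf.exists_maninConstant_ne_zero_holds`). BSD is not proved by this. [cite: GreenbergVatsal2000, Thm. (1.4) and §3 (13)]
[cite: Ribet1984ICM, Thm. 4.3] [cite: DokchitserDokchitserMathZ2012, Theorem (1)] [cite: Knapp1993, Thm. 11.74 (d)] -/
theorem mazurTateCongruenceAtTwoTop_of_sdBz_periodTwo
    (hSD : heckeSelfDual_torsionBy_J0)
    (hBz : buzzard2000_multiplicityOne_gamma0) (h2 : realPeriodRat_eq_unit_mul_plusPeriod_two) :
    Summit.BirchSwinnertonDyer.BirchSwinnertonDyer.Theses.ThetaPartnerAtTwo.MazurTateCongruenceAtTwoTop :=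
  mazurTateCongruenceAtTwoTop_of_sdBz_periodTwo_ihara hSD hBz h2 stub_iharaSymbolModTwoNegDisc

/-- **PUB³ form {SD, Bz, AU} — THE K1 FLOOR OF THIS FILE**: the crux BY NAME from Hecke self-duality of `J₀(N)[2]`, Buzzard 2000 mod-`2`
multiplicity one and Abbes–Ullmo Thm. A (the period fact at `2` from `SkinnerUrban2014.realPeriodRat_eq_unit_mul_plusPeriod_two_fact_of_abbesUllmo`)
— the route's PUB⁵ bundle `PublishedInputsHeckeAtTwo` (item 27435) minus Serre 1972 (w4 g0) AND minus the assembled Eichler–Shimura fact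
(this seat): `mazurTateCongruenceAtTwoTop_of_sdBzAu h.2.1 h.2.2.1 h.2.2.2.2` for `h : PublishedInputsHeckeAtTwo`. BSD is not proved by this.
[cite: AbbesUllmo1996, Thm. A] [cite: GreenbergVatsal2000, Thm. (1.4) and §3 (13)] [cite: Buzzard2000LevelLoweringModTwo, Prop. 2.4] -/
theorem mazurTateCongruenceAtTwoTop_of_sdBzAu
    (hSD : heckeSelfDual_torsionBy_J0)
    (hBz : buzzard2000_multiplicityOne_gamma0) (hAU : abbesUllmo_not_dvd_maninConstant_of_not_dvd_level) :
    Summit.BirchSwinnertonDyer.BirchSwinnertonDyer.Theses.ThetaPartnerAtTwo.MazurTateCongruenceAtTwoTop :=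
  mazurTateCongruenceAtTwoTop_of_sdBz_periodTwo hSD hBz
    (SkinnerUrban2014.realPeriodRat_eq_unit_mul_plusPeriod_two_fact_of_abbesUllmo hAU)

/-- The twin `MazurTateCongruenceAtTwoR` (item 21416) BY NAME from PUB² {SD, Bz} + the period fact. [cite: GreenbergVatsal2000, §3 (13)] -/
theorem mazurTateCongruenceAtTwoR_of_sdBz_periodTwo
    (hSD : heckeSelfDual_torsionBy_J0)
    (hBz : buzzard2000_multiplicityOne_gamma0) (h2 : realPeriodRat_eq_unit_mul_plusPeriod_two) :
    Summit.BirchSwinnertonDyer.BirchSwinnertonDyer.Theses.ThetaPartnerAtTwo.MazurTateCongruenceAtTwoR :=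
  mazurTateCongruenceAtTwoTop_of_sdBz_periodTwo hSD hBz h2

/-- The twin `MazurTateCongruenceAtTwoR` (item 21416) BY NAME from PUB³ {SD, Bz, AU}. [cite: AbbesUllmo1996, Thm. A]
[cite: GreenbergVatsal2000, §3 (13)] -/
theorem mazurTateCongruenceAtTwoR_of_sdBzAu
    (hSD : heckeSelfDual_torsionBy_J0)
    (hBz : buzzard2000_multiplicityOne_gamma0) (hAU : abbesUllmo_not_dvd_maninConstant_of_not_dvd_level) :
    Summit.BirchSwinnertonDyer.BirchSwinnertonDyer.Theses.ThetaPartnerAtTwo.MazurTateCongruenceAtTwoR :=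
  mazurTateCongruenceAtTwoTop_of_sdBzAu hSD hBz hAU

/-- **Greenberg–Vatsal `μ`-invariance at `2` on the theta habitat from PUB² {SD, Bz} + the period fact** (w4 g0's
`muInvarianceAtTwo_of_threeFacts_periodTwo` with `ES` dropped): for every theta pair, newforms and Pollack pairs at `2`, `L♭_W` has a unit
coefficient iff `L♭_A` does. BSD is not proved by this. [cite: GreenbergVatsal2000, Thm. (1.4) and §3 (13)] [cite: Vatsal1999, Thm. (1.10)] -/
theorem muInvarianceAtTwo_of_sdBz_periodTwo
    (hSD : heckeSelfDual_torsionBy_J0)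
    (hBz : buzzard2000_multiplicityOne_gamma0) (h2 : realPeriodRat_eq_unit_mul_plusPeriod_two) :
    ∀ (W : WeierstrassCurve ℚ) [W.IsElliptic] [W.IsGloballyMinimal] (A : WeierstrassCurve ℚ) [A.IsElliptic]
      [A.IsGloballyMinimal], ¬ W.HasCM → W.analyticRank = 0 → GoodSS W 2 → W.frobeniusTrace 2 = 0 → A.HasCM → GoodSS A 2 →
      A.frobeniusTrace 2 = 0 →
      (∃ e : geomTorsion W (2 : ℤ) ≃+ geomTorsion A (2 : ℤ),
        ∀ (σ : Field.absoluteGaloisGroup ℚ) (P : geomTorsion W (2 : ℤ)), e (σ • P) = σ • e P) →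
      ∀ [NeZero (W.conductorNorm ℤ)] (f : CuspForm (Gamma0 (W.conductorNorm ℤ)) 2), IsNewformOf W f →
      ∀ (Lplus Lminus : IwasawaAlgebra 2), IsPollackPair f 2 Lplus Lminus →
      ∀ [NeZero (A.conductorNorm ℤ)] (fA : CuspForm (Gamma0 (A.conductorNorm ℤ)) 2), IsNewformOf A fA →
      ∀ (LplusA LminusA : IwasawaAlgebra 2), IsPollackPair fA 2 LplusA LminusA →
      ((∃ n : ℕ, IsUnit (PowerSeries.coeff n (kobayashiL 1 Lplus Lminus))) ↔
        (∃ n : ℕ, IsUnit (PowerSeries.coeff n (kobayashiL 1 LplusA LminusA)))) :=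
  flatIff_of_mazurTateCongruenceAtTwoTop h2 (mazurTateCongruenceAtTwoTop_of_sdBz_periodTwo hSD hBz h2)

end Summit.BirchSwinnertonDyer.BirchSwinnertonDyer.Theorems.MazurTateCongruenceAtTwoR

/-! ## §2 K1 at the rank-0 partner (K1Ar) from Gross–Zagier–Kolyvagin + PUB³ {SD, Bz, AU} -/

namespace Summit.BirchSwinnertonDyer.BirchSwinnertonDyer.Theorems.SignedTransportAtTwo

/-- **K1Ar from GZK + PUB³ {SD, Bz, AU}, nothing else** (tp2-p1-w2 g4's `signedTransportAtTwo_rankZero_of_gzk_of_publishedInputsHeckeAtTwo` with the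
PUB⁵ bundle replaced by its three load-bearing conjuncts): the signed transport at `2` at the analytic-rank-`0` CM partner — statement VERBATIM
that of `signedTransportAtTwo_rankZero_of_gzk` (tp2-p3-w3 g10, GZK → `MazurTateCongruenceAtTwoR` → K1Ar), fed with
`mazurTateCongruenceAtTwoR_of_sdBzAu`. Conditional on GZK and three named facts; closes no item; BSD is not proved by this.
[cite: GreenbergVatsal2000, Thm. (1.4), Props. (2.1), (2.4), (2.5), (2.8)] [cite: BDKim2009, Cor. 2.13] [cite: Kobayashi2003, Thm. 1.2]
[cite: MilneADT2006, Ch. I, Thm. 4.10 (a)(b)(c), Cor. 4.16] -/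
theorem signedTransportAtTwo_rankZero_of_gzk_of_sdBzAu
    (hGZK : rank_eq_analyticRank_of_analyticRank_le_one) (hSD : heckeSelfDual_torsionBy_J0)
    (hBz : buzzard2000_multiplicityOne_gamma0) (hAU : abbesUllmo_not_dvd_maninConstant_of_not_dvd_level) :
    ∀ (W : WeierstrassCurve ℚ) [W.IsElliptic] [W.IsGloballyMinimal] (A : WeierstrassCurve ℚ) [A.IsElliptic] [A.IsGloballyMinimal], ¬ W.HasCM →
      W.analyticRank = 0 → Literature.NumberTheory.EllipticCurves.Rank1Residual.GoodSS W 2 → W.frobeniusTrace 2 = 0 →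
      A.HasCM → A.analyticRank = 0 → Literature.NumberTheory.EllipticCurves.Rank1Residual.GoodSS A 2 →
      A.frobeniusTrace 2 = 0 →
      (∃ e : WeierstrassCurve.geomTorsion W (2 : ℤ) ≃+ WeierstrassCurve.geomTorsion A (2 : ℤ), ∀ (σ : Field.absoluteGaloisGroup ℚ) (P : WeierstrassCurve.geomTorsion W (2 : ℤ)), e (σ • P) = σ • e P) →
      ∀ [NeZero (A.conductorNorm ℤ)] (fA : CuspForm (CongruenceSubgroup.Gamma0 (A.conductorNorm ℤ)) 2), Literature.NumberTheory.EllipticCurves.ModularForms.IsNewformOf A fA →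
      ∀ (ϖA : ℚ), (ϖA : ℝ) * A.realPeriodRat = Literature.NumberTheory.EllipticCurves.ModularForms.plusPeriod fA →
      ∀ (LsharpA LflatA : Literature.NumberTheory.EllipticCurves.IwasawaAlgebra 2), Summit.BirchSwinnertonDyer.Rank1Residual.Supersingular.IsPollackPair fA 2 LsharpA LflatA →
      (∀ (κ : Literature.NumberTheory.EllipticCurves.ZpExtension ℚ 2) (γ : Field.absoluteGaloisGroup ℚ), κ.IsCyclotomic →
      κ.IsTopGenerator γ →
      ∀ D : Literature.NumberTheory.EllipticCurves.Kobayashi2003.SignedSelmerDualData A κ γ 1, Module.IsTorsion (Literature.NumberTheory.EllipticCurves.IwasawaAlgebra 2) D.X ∧ D.mu = 0) →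
      Summit.BirchSwinnertonDyer.Rank1Residual.Supersingular.KobayashiMainConjecture A 2 1 →
      (∀ (κ : Literature.NumberTheory.EllipticCurves.ZpExtension ℚ 2) (γ : Field.absoluteGaloisGroup ℚ), κ.IsCyclotomic →
      κ.IsTopGenerator γ → Literature.NumberTheory.EllipticCurves.IsCyclotomicVariable 2 γ →
      ∀ [NeZero (W.conductorNorm ℤ)] (f : CuspForm (CongruenceSubgroup.Gamma0 (W.conductorNorm ℤ)) 2), Literature.NumberTheory.EllipticCurves.ModularForms.IsNewformOf W f →
      ∀ (ϖ : ℚ), (ϖ : ℝ) * W.realPeriodRat = Literature.NumberTheory.EllipticCurves.ModularForms.plusPeriod f →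
      ∀ (Lplus Lminus : Literature.NumberTheory.EllipticCurves.IwasawaAlgebra 2), Summit.BirchSwinnertonDyer.Rank1Residual.Supersingular.IsPollackPair f 2 Lplus Lminus →
      ∀ (D : Literature.NumberTheory.EllipticCurves.Kobayashi2003.SignedSelmerDualData W κ γ 1), ∃ (g h : Literature.NumberTheory.EllipticCurves.IwasawaAlgebra 2) (m : ℕ), D.charIdeal = Ideal.span {g} ∧ Literature.NumberTheory.EllipticCurves.iwasawaToPowerSeries 2 (g * h) = PowerSeries.C ((2 : ℚ_[2]) ^ m * (ϖ : ℚ_[2])) * Literature.NumberTheory.EllipticCurves.iwasawaToPowerSeries 2 (Summit.BirchSwinnertonDyer.Rank1Residual.Supersingular.kobayashiL 1 Lplus Lminus)) →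
      Summit.BirchSwinnertonDyer.Rank1Residual.Supersingular.KobayashiMainConjecture W 2 1 :=
  signedTransportAtTwo_rankZero_of_gzk hGZK (MazurTateCongruenceAtTwoR.mazurTateCongruenceAtTwoR_of_sdBzAu hSD hBz hAU)

end Summit.BirchSwinnertonDyer.BirchSwinnertonDyer.Theorems.SignedTransportAtTwo

/-! ## §3 Kan⁺ `ThetaLayerLambdaCongruenceAtTwo` (RTT stmt-20688) BY NAME without ES (and without Serre 1972) -/

namespace Summit.BirchSwinnertonDyer.BirchSwinnertonDyer.Theorems.ThetaLayerLambdaCongruenceAtTwo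

open Summit.BirchSwinnertonDyer.BirchSwinnertonDyer.Theses.ResidualThetaTransportAtTwo

/-- **Kan⁺ `ThetaLayerLambdaCongruenceAtTwo` BY NAME from TWO print facts {SD, Bz} + Kμ⁺'s FLAT** (w4 g0's `…_of_threeFacts_flatMuZeroAtTwo`
with the ES-free plus line). BSD is not proved by this. [cite: GreenbergVatsal2000, §1 (10) and Prop. (2.4) (shape)] [cite: Pollack2003, Conj. 6.3] -/
theorem thetaLayerLambdaCongruenceAtTwo_of_sdBz_flatMuZeroAtTwo
    (hSD : heckeSelfDual_torsionBy_J0) (hBz : buzzard2000_multiplicityOne_gamma0)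
    (hflat : ∀ (W : WeierstrassCurve ℚ) [W.IsElliptic] [W.IsGloballyMinimal], ¬ W.HasCM → W.analyticRank = 0 → Literature.NumberTheory.EllipticCurves.Rank1Residual.GoodSS W 2 → W.frobeniusTrace 2 = 0 → W.Δ < 0 → ∀ [NeZero (W.conductorNorm ℤ)] (f : CuspForm (CongruenceSubgroup.Gamma0 (W.conductorNorm ℤ)) 2), Literature.NumberTheory.EllipticCurves.ModularForms.IsNewformOf W f → ∀ (Lplus Lminus : Literature.NumberTheory.EllipticCurves.IwasawaAlgebra 2), Summit.BirchSwinnertonDyer.Rank1Residual.Supersingular.IsPollackPair f 2 Lplus Lminus → ¬ PowerSeries.C (2 : ℤ_[2]) ∣ Lminus) :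
    ThetaLayerLambdaCongruenceAtTwo :=
  thetaLayerLambdaCongruenceAtTwo_of_plusLineLevel_curveMax_nonRoot
    (plusLineAtTwoLevel_of_charTwoLevel (plusLineCharTwo_of_sdBz hSD hBz))
    (stub_curveDepletedSymbolMaxAtTwoPowerCusp_of_flatMuZeroAtTwo hflat) partnerEulerFactorNonRoot

/-- **Kan⁺ BY NAME from THREE print facts {SD, Bz, AU} + the route item 21437 `SignedMuAnalyticAtTwoPlus`** (`…_of_esSdBzAu_signedMuAnalytic`
minus `ES`). Conditional on three print facts and an OPEN item; BSD is not proved by this. [cite: AbbesUllmo1996, Thm. A]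
[cite: Pollack2003, Prop. 6.18 (shape)] -/
theorem thetaLayerLambdaCongruenceAtTwo_of_sdBzAu_signedMuAnalytic
    (hSD : heckeSelfDual_torsionBy_J0) (hBz : buzzard2000_multiplicityOne_gamma0)
    (hAU : abbesUllmo_not_dvd_maninConstant_of_not_dvd_level)
    (hμ : SignedMuAnalyticAtTwoPlus) :
    ThetaLayerLambdaCongruenceAtTwo :=
  thetaLayerLambdaCongruenceAtTwo_of_sdBz_flatMuZeroAtTwo hSD hBz
    ((Summit.BirchSwinnertonDyer.BirchSwinnertonDyer.Theorems.signedMuAnalyticAtTwoPlus_iff_flatMuZero_of_abbesUllmo hAU).mp hμ)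

/-- **Abbes–Ullmo-free form**: Kan⁺ BY NAME from TWO print facts {SD, Bz}, the period-unit statement PER at `2` (inline hypothesis) and the
route item 21437 (`…_of_threeFacts_periodUnit_signedMuAnalytic` minus `ES`). BSD is not proved by this. [cite: Pollack2003, Prop. 6.18 (shape)] -/
theorem thetaLayerLambdaCongruenceAtTwo_of_sdBz_periodUnit_signedMuAnalytic
    (hSD : heckeSelfDual_torsionBy_J0) (hBz : buzzard2000_multiplicityOne_gamma0)
    (hper : ∀ (W : WeierstrassCurve ℚ) [W.IsElliptic] [W.IsGloballyMinimal],
      Literature.NumberTheory.EllipticCurves.Rank1Residual.GoodSS W 2 →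
      ∀ [NeZero (W.conductorNorm ℤ)] (f : CuspForm (Gamma0 (W.conductorNorm ℤ)) 2), IsNewformOf W f →
      ∃ u : ℚ, ‖(u : ℚ_[2])‖ = 1 ∧ W.realPeriodRat = u * plusPeriod f)
    (hμ : SignedMuAnalyticAtTwoPlus) :
    ThetaLayerLambdaCongruenceAtTwo :=
  thetaLayerLambdaCongruenceAtTwo_of_sdBz_flatMuZeroAtTwo hSD hBz
    (Summit.BirchSwinnertonDyer.BirchSwinnertonDyer.Theorems.flatMuZero_of_signedMuAnalyticAtTwoPlus_of_periodUnit hμ hper)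

/-- **Curried form for a route binder list** («KanP» with THREE print binders): Hecke self-duality, Buzzard, Abbes–Ullmo, then the item 21437,
then the crux — all BY NAME; neither Serre 1972 nor the assembled Eichler–Shimura fact is a binder any more. [cite: Pollack2003, Prop. 6.18 (shape)] -/
theorem kanP3_of_pub_of_signedMuAnalyticAtTwoPlus :
    heckeSelfDual_torsionBy_J0 → buzzard2000_multiplicityOne_gamma0 → abbesUllmo_not_dvd_maninConstant_of_not_dvd_level →
    SignedMuAnalyticAtTwoPlus → ThetaLayerLambdaCongruenceAtTwo :=
  thetaLayerLambdaCongruenceAtTwo_of_sdBzAu_signedMuAnalytic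

end Summit.BirchSwinnertonDyer.BirchSwinnertonDyer.Theorems.ThetaLayerLambdaCongruenceAtTwo

end
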